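import Summits.QuantumFields.YangMills.Theorems.BalabanLadderIRTwistedSlabTorusTime
import HarnessLib

/-!
# The covering `ℤ_{kn} × Y → ℤ_n × Y` for subset polymers: projection, sheet lifts, and the one-sheet lemma for short sets (K47b)

HELPER toward stub **T1** `TwistedSlabAnchor` of LINE `twisted-slab-continuity` (crux `IRcof`,
stmt-QuantumFields-26930, census row 43; LEAD prover ym-ir-line-tsc-p1 g7; `--supports` the crux, `--as helper`):
brick **(m6)** of the M4 anatomy of memo `Cruxes/IRcof/T1-ANATOMY-tsc-p1.md` §16.3 — the TORUS FINITE-SIZE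
bookkeeping of a Kotecký–Preiss polymer expansion of `log projSlabZ`, done model-free on the tree's PROVED KP layer
(`Literature/Probability/LatticeModels/{ClusterExpansion, ClusterExpansionKPBound, PolymerPressure}`), so that an
eventual M4 line only has to produce the polymer representation ((m1)(m2)(m4)(m5)) and read off
`|log Ξ_{2t} − 2 log Ξ_t| ≤ A·t·L·e^{−ct}`. Nothing here is specific to gauge theory; T1 is NOT advanced by this file
alone (HONEST: T1 0∕1 = M4 + hcl; the Yang–Mills mass gap is NOT proved).

Second file of the torus finite-size bookkeeping for Kotecký–Preiss polymer gases
(K47a `…TorusTime.lean` ⟵ this file ⟵ K47c `…TorusDoubling.lean`). For `N = k n`: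

* `proj n : X_N → X_n`, `(t, y) ↦ (t mod n, y)`, with `projSet` / `projFam` on polymers and
  families of polymers; `liftPt c : X_n → X_N`, the lift into the arc of `n` consecutive times
  starting at `c ∈ ℤ_N`, with `liftSet` / `liftFam`; `proj ∘ liftPt c = id` (`proj_liftPt`),
  injectivity, `clusterSupp` compatibility, and invariance of the meet-or-equal incompatibility
  (`polyInc_liftSet_iff`).
* `liftPt_proj_of_val_lt`, `liftFam_projFam_of_forall_val_lt`: a site/set/family inside the arc of
  `n` times starting at `c` IS the lift of its projection.
* `exists_sheet` (every `z ∈ ℤ_N` is `a + i n + j`, `i < k`, `j < n`), `sheet_eq_of_short` and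
  `exists_sheet_of_isTimeShort`: an `ℓ`-short set upstairs with `2ℓ ≤ n` lies in ONE sheet over
  its (short) projection — short polymers have no "mixed" lifts; `liftSet_sheet_injOn`: the `k`
  sheet lifts `liftSet (liftBase a + i n) S`, `i < k`, of a non-empty `S` are distinct.

These are the ingredients of the exact `k : 1` correspondence of short clusters under the
covering (K47c `filter_projFam_eq_image`). Everything here is PROVED (elementary `ZMod`
arithmetic); 0 sorry.

## References

* [KP86] R. Kotecký, D. Preiss, Comm. Math. Phys. 103 (1986) 491–498, p. 493 (translation
  invariant case: clusters of different tori are identified). [KoteckyPreiss1986]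
* C. Borgs, R. Kotecký, J. Stat. Phys. 61 (1990) 79–119, §1. [BorgsKotecky1990]
-/

noncomputable section

open Finset
open scoped BigOperators
open Literature.Probability.LatticeModels

namespace Summit.QuantumFields.YangMills.Cruxes.IRcof.TwistedSlab

namespace PolymerTorus

/-! ### The covering `ℤ_{kn} × Y → ℤ_n × Y` and lifts of short sets -/

section Covering

variable {k n N : ℕ} {Y : Type*}

/-- The covering projection `X_N → X_n`, `(t, y) ↦ (t mod n, y)` (a group homomorphism on the time
coordinate when `n ∣ N`). [folklore] -/
def proj (n : ℕ) (x : ZMod N × Y) : ZMod n × Y := ((ZMod.cast x.1 : ZMod n), x.2)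

/-- Projection of a subset polymer. [folklore] -/
def projSet [DecidableEq Y] (n : ℕ) (A : Finset (ZMod N × Y)) : Finset (ZMod n × Y) :=
  A.image (proj n)

/-- Projection of a family of subset polymers. [folklore] -/
def projFam [DecidableEq Y] (n : ℕ) (C : Finset (Finset (ZMod N × Y))) :
    Finset (Finset (ZMod n × Y)) :=
  C.image (projSet n)

/-- The lift of a site of `X_n` into the arc of `n` consecutive times of `X_N` starting at `c`:
`(t, y) ↦ (c + ((t - c̄) mod n), y)`, `c̄ = c mod n`. [folklore] -/
def liftPt (c : ZMod N) (x : ZMod n × Y) : ZMod N × Y :=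
  (c + (((x.1 - (ZMod.cast c : ZMod n)).val : ℕ) : ZMod N), x.2)

/-- Lift of a subset polymer along `liftPt c`. [folklore] -/
def liftSet [DecidableEq Y] (c : ZMod N) (A : Finset (ZMod n × Y)) : Finset (ZMod N × Y) :=
  A.image (liftPt c)

/-- Lift of a family of subset polymers along `liftSet c`. [folklore] -/
def liftFam [DecidableEq Y] (c : ZMod N) (C : Finset (Finset (ZMod n × Y))) :
    Finset (Finset (ZMod N × Y)) :=
  C.image (liftSet c)

/-- `N = k n` gives `n ∣ N`. [folklore] -/
theorem dvd_of_eq_mul (hN : N = k * n) : n ∣ N := ⟨k, by rw [hN, mul_comm]⟩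

/-- `N = k n ≠ 0` gives `0 < k`. [folklore] -/
theorem pos_of_eq_mul [NeZero N] (hN : N = k * n) : 0 < k :=
  Nat.pos_of_ne_zero fun hk => NeZero.ne N (by rw [hN, hk, zero_mul])

/-- `N = k n ≠ 0` gives `n ≤ N`. [folklore] -/
theorem le_of_eq_mul [NeZero N] (hN : N = k * n) : n ≤ N := by
  rw [hN]; exact Nat.le_mul_of_pos_left n (pos_of_eq_mul hN)

/-- `proj ∘ liftPt c = id`. [folklore] -/
theorem proj_liftPt [NeZero n] (hN : N = k * n) (c : ZMod N) (x : ZMod n × Y) :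
    proj n (liftPt c x) = x := by
  have hdvd := dvd_of_eq_mul hN
  unfold proj liftPt
  ext
  · simp only
    rw [ZMod.cast_add hdvd, ZMod.cast_natCast hdvd, ZMod.natCast_zmod_val]
    abel
  · rfl

/-- `liftPt c` is injective. [folklore] -/
theorem liftPt_injective [NeZero n] (hN : N = k * n) (c : ZMod N) :
    Function.Injective (liftPt (n := n) (Y := Y) c) :=
  Function.LeftInverse.injective (proj_liftPt hN c)

variable [DecidableEq Y]

/-- `liftSet c` is injective. [folklore] -/
theorem liftSet_injective [NeZero n] (hN : N = k * n) (c : ZMod N) :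
    Function.Injective (liftSet (n := n) (Y := Y) c) :=
  Finset.image_injective (liftPt_injective hN c)

/-- `projSet ∘ liftSet c = id`. [folklore] -/
theorem projSet_liftSet [NeZero n] (hN : N = k * n) (c : ZMod N) (A : Finset (ZMod n × Y)) :
    projSet n (liftSet c A) = A := by
  unfold projSet liftSet
  rw [Finset.image_image]
  have : proj n ∘ liftPt (Y := Y) c = id := funext (proj_liftPt hN c)
  rw [this, Finset.image_id]

/-- `projFam ∘ liftFam c = id`. [folklore] -/
theorem projFam_liftFam [NeZero n] (hN : N = k * n) (c : ZMod N) (C : Finset (Finset (ZMod n × Y))) :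
    projFam n (liftFam c C) = C := by
  unfold projFam liftFam
  rw [Finset.image_image]
  have : projSet n ∘ liftSet (Y := Y) c = id := funext (projSet_liftSet hN c)
  rw [this, Finset.image_id]

/-- The support of a lifted family is the lift of the support. [folklore] -/
theorem clusterSupp_liftFam (c : ZMod N) (C : Finset (Finset (ZMod n × Y))) :
    clusterSupp (liftFam c C) = liftSet c (clusterSupp C) := by
  unfold clusterSupp liftFam liftSet
  rw [Finset.image_biUnion, Finset.biUnion_image]
  rfl

/-- The support of a projected family is the projection of the support. [folklore] -/
theorem clusterSupp_projFam (C : Finset (Finset (ZMod N × Y))) :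
    clusterSupp (projFam n C) = projSet n (clusterSupp C) := by
  unfold clusterSupp projFam projSet
  rw [Finset.image_biUnion, Finset.biUnion_image]
  rfl

/-- Incompatibility (equal or meeting) is invariant under the injective lift `liftSet c`. [folklore] -/
theorem polyInc_liftSet_iff [NeZero n] (hN : N = k * n) (c : ZMod N) (A B : Finset (ZMod n × Y)) :
    polyInc (liftSet c A) (liftSet c B) ↔ polyInc A B := by
  unfold polyInc
  refine or_congr (liftSet_injective hN c).eq_iff ?_
  unfold liftSet
  rw [← Finset.image_inter _ _ (liftPt_injective hN c), Finset.image_nonempty]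

omit [DecidableEq Y] in
/-- The time of a lifted site relative to the base of the arc: `(liftPt c x).1 - c = (x.1 - c̄).val`.
[folklore] -/
theorem liftPt_fst_sub (c : ZMod N) (x : ZMod n × Y) :
    (liftPt c x).1 - c = (((x.1 - (ZMod.cast c : ZMod n)).val : ℕ) : ZMod N) := by
  unfold liftPt
  simp only
  abel

omit [DecidableEq Y] in
/-- A lifted site lies in the arc of `n` times starting at `c`; more precisely its offset is the
offset of `x` from `c̄` downstairs. [folklore] -/
theorem val_liftPt_fst_sub [NeZero n] [NeZero N] (hN : N = k * n) (c : ZMod N) (x : ZMod n × Y) :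
    ((liftPt c x).1 - c).val = (x.1 - (ZMod.cast c : ZMod n)).val := by
  rw [liftPt_fst_sub]
  exact ZMod.val_natCast_of_lt (lt_of_lt_of_le (ZMod.val_lt _) (le_of_eq_mul hN))

omit [DecidableEq Y] in
/-- **A site in the arc of `n` times starting at `c` is the lift of its projection.** [folklore] -/
theorem liftPt_proj_of_val_lt [NeZero n] [NeZero N] (hN : N = k * n) {c : ZMod N} {x : ZMod N × Y}
    (hx : (x.1 - c).val < n) : liftPt c (proj n x) = x := by
  have hdvd := dvd_of_eq_mul hN
  unfold liftPt proj
  ext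
  · simp only
    have h1 : ((ZMod.cast x.1 : ZMod n) - (ZMod.cast c : ZMod n)) = (ZMod.cast (x.1 - c) : ZMod n) :=
      (ZMod.cast_sub hdvd _ _).symm
    rw [h1, ZMod.cast_eq_val, ZMod.val_natCast, Nat.mod_eq_of_lt hx, ZMod.natCast_zmod_val]
    abel
  · rfl

/-- A set inside the arc of `n` times starting at `c` is the lift of its projection. [folklore] -/
theorem liftSet_projSet_of_forall_val_lt [NeZero n] [NeZero N] (hN : N = k * n) {c : ZMod N}
    {A : Finset (ZMod N × Y)} (hA : ∀ x ∈ A, (x.1 - c).val < n) : liftSet c (projSet n A) = A := by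
  unfold liftSet projSet
  rw [Finset.image_image]
  refine (Finset.image_congr (g := id) fun x hx => ?_).trans Finset.image_id
  exact liftPt_proj_of_val_lt hN (hA x hx)

/-- A family whose support lies inside the arc of `n` times starting at `c` is the lift of its
projection. [folklore] -/
theorem liftFam_projFam_of_forall_val_lt [NeZero n] [NeZero N] (hN : N = k * n) {c : ZMod N}
    {C : Finset (Finset (ZMod N × Y))} (hC : ∀ x ∈ clusterSupp C, (x.1 - c).val < n) :
    liftFam c (projFam n C) = C := by
  unfold liftFam projFam
  rw [Finset.image_image]
  refine (Finset.image_congr (g := id) fun A hA => ?_).trans Finset.image_id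
  exact liftSet_projSet_of_forall_val_lt hN fun x hx => hC x (subset_clusterSupp hA hx)

/-- Projections of `ℓ`-short sets are `ℓ`-short (with the projected base point). [folklore] -/
theorem isTimeShort_projSet [NeZero n] [NeZero N] (hN : N = k * n) {ℓ : ℕ} {A : Finset (ZMod N × Y)}
    (hA : IsTimeShort ℓ A) : IsTimeShort ℓ (projSet n A) := by
  have hdvd := dvd_of_eq_mul hN
  obtain ⟨b, hb⟩ := hA
  refine ⟨ZMod.cast b, fun x hx => ?_⟩
  obtain ⟨x', hx', rfl⟩ := Finset.mem_image.1 hx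
  show ((ZMod.cast x'.1 : ZMod n) - ZMod.cast b).val < ℓ
  rw [← ZMod.cast_sub hdvd, ZMod.cast_eq_val, ZMod.val_natCast]
  exact lt_of_le_of_lt (Nat.mod_le _ _) (hb x' hx')

omit [DecidableEq Y] in
/-- **Sheet decomposition of `ℤ_N` over `ℤ_n`** (`N = k n`): every `z` is `a + i·n + j` with
`i < k` and `j = (z̄ - ā).val < n`, bars denoting reduction mod `n`. [folklore] -/
theorem exists_sheet [NeZero n] [NeZero N] (hN : N = k * n) (z a : ZMod N) :
    ∃ i < k, z = a + ((i * n : ℕ) : ZMod N) +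
      ((((ZMod.cast z : ZMod n) - ZMod.cast a).val : ℕ) : ZMod N) := by
  have hdvd := dvd_of_eq_mul hN
  have hval : ((ZMod.cast z : ZMod n) - ZMod.cast a).val = (z - a).val % n := by
    rw [← ZMod.cast_sub hdvd, ZMod.cast_eq_val, ZMod.val_natCast]
  obtain ⟨v, hv⟩ : ∃ v : ℕ, (z - a).val = v := ⟨_, rfl⟩
  refine ⟨v / n, ?_, ?_⟩
  · rw [Nat.div_lt_iff_lt_mul (Nat.pos_of_ne_zero (NeZero.ne n)), ← hN, ← hv]
    exact ZMod.val_lt _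
  · rw [hval, hv]
    have hza : z - a = ((v / n * n : ℕ) : ZMod N) + ((v % n : ℕ) : ZMod N) := by
      rw [← Nat.cast_add, Nat.div_add_mod', ← hv, ZMod.natCast_zmod_val]
    calc z = a + (z - a) := by abel
      _ = _ := by rw [hza, add_assoc]

omit [DecidableEq Y] in
/-- **Separation of sheets**: two times of the form `a + i n + j`, `a + i' n + j'` with
`i, i' < k`, `j, j' < ℓ`, both inside one arc of `ℓ` consecutive times, `2ℓ ≤ n`, lie in the same
sheet: `i = i'` (short sets upstairs have no "mixed" lifts). [folklore] -/
theorem sheet_eq_of_short [NeZero N] (hN : N = k * n) {ℓ : ℕ} (hℓ : 2 * ℓ ≤ n) {a b z z' : ZMod N}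
    {i i' j j' : ℕ} (hi : i < k) (hi' : i' < k) (hj : j < ℓ) (hj' : j' < ℓ)
    (hz : z = a + ((i * n : ℕ) : ZMod N) + ((j : ℕ) : ZMod N))
    (hz' : z' = a + ((i' * n : ℕ) : ZMod N) + ((j' : ℕ) : ZMod N))
    (hzb : (z - b).val < ℓ) (hz'b : (z' - b).val < ℓ) : i = i' := by
  have hn : 0 < n := by omega
  set m := (z - b).val with hm
  set m' := (z' - b).val with hm'
  have e1 : z - b = (m : ZMod N) := (ZMod.natCast_zmod_val (z - b)).symm
  have e2 : z' - b = (m' : ZMod N) := (ZMod.natCast_zmod_val (z' - b)).symm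
  have key : ((j + m' + i * n : ℕ) : ZMod N) = ((j' + m + i' * n : ℕ) : ZMod N) := by
    have h : z + (m' : ZMod N) = z' + (m : ZMod N) := by
      calc z + (m' : ZMod N) = (z - b) + b + m' := by abel
        _ = m + b + m' := by rw [e1]
        _ = (z' - b) + b + m := by rw [e2]; abel
        _ = z' + m := by abel
    rw [hz, hz'] at h
    push_cast at h ⊢
    linear_combination h
  rw [ZMod.natCast_eq_natCast_iff'] at key
  have hb1 : j + m' + i * n < N := by
    have := Nat.mul_le_mul_right n (Nat.succ_le_of_lt hi)
    rw [Nat.succ_mul, ← hN] at this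
    omega
  have hb2 : j' + m + i' * n < N := by
    have := Nat.mul_le_mul_right n (Nat.succ_le_of_lt hi')
    rw [Nat.succ_mul, ← hN] at this
    omega
  rw [Nat.mod_eq_of_lt hb1, Nat.mod_eq_of_lt hb2] at key
  have hq : (j + m' + i * n) / n = (j' + m + i' * n) / n := by rw [key]
  rwa [Nat.add_mul_div_right _ _ hn, Nat.add_mul_div_right _ _ hn,
    Nat.div_eq_of_lt (by omega : j + m' < n), Nat.div_eq_of_lt (by omega : j' + m < n),
    zero_add, zero_add] at hq

omit [DecidableEq Y] in
/-- **Short sets upstairs lie in one sheet**: if `S ⊆ X_N` is `ℓ`-short (`2ℓ ≤ n`) and its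
projection is `ℓ`-short with base point `ā`, `a ∈ X_N`, then for ONE sheet index `i < k` all of `S`
lies in the arc of `ℓ` times starting at `a + i n`. [folklore] -/
theorem exists_sheet_of_isTimeShort [NeZero n] [NeZero N] (hN : N = k * n) {ℓ : ℕ} (hℓ : 2 * ℓ ≤ n)
    {S : Finset (ZMod N × Y)} (hS : IsTimeShort ℓ S) (a : ZMod N)
    (ha : ∀ x ∈ S, ((ZMod.cast x.1 : ZMod n) - ZMod.cast a).val < ℓ) :
    ∃ i < k, ∀ x ∈ S, (x.1 - (a + ((i * n : ℕ) : ZMod N))).val < ℓ := by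
  rcases S.eq_empty_or_nonempty with hSe | ⟨x₀, hx₀⟩
  · exact ⟨0, pos_of_eq_mul hN, fun x hx => by rw [hSe] at hx; exact (Finset.notMem_empty _ hx).elim⟩
  obtain ⟨b, hb⟩ := hS
  obtain ⟨i₀, hi₀, hz₀⟩ := exists_sheet hN x₀.1 a
  set j₀ := ((ZMod.cast x₀.1 : ZMod n) - ZMod.cast a).val with hj₀
  refine ⟨i₀, hi₀, fun x hx => ?_⟩
  obtain ⟨i, hi, hz⟩ := exists_sheet hN x.1 a
  set j := ((ZMod.cast x.1 : ZMod n) - ZMod.cast a).val with hj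
  have hii : i = i₀ :=
    sheet_eq_of_short hN hℓ hi hi₀ (ha x hx) (ha x₀ hx₀) hz hz₀ (hb x hx) (hb x₀ hx₀)
  subst hii
  have hrew : x.1 - (a + ((i * n : ℕ) : ZMod N)) = ((j : ℕ) : ZMod N) := by
    rw [hz]; abel
  rw [hrew, ZMod.val_natCast_of_lt (lt_of_lt_of_le (ha x hx)
    ((by omega : ℓ ≤ n).trans (le_of_eq_mul hN)))]
  exact ha x hx

/-- The base point of the sheets over `ā ∈ ℤ_n`: `liftBase a = (a.val : ℤ_N)` reduces to `a`.
[folklore] -/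
def liftBase (N : ℕ) (a : ZMod n) : ZMod N := ((a.val : ℕ) : ZMod N)

omit [DecidableEq Y] in
/-- `liftBase a` reduces to `a` mod `n`. [folklore] -/
theorem cast_liftBase [NeZero n] (hN : N = k * n) (a : ZMod n) :
    (ZMod.cast (liftBase N a) : ZMod n) = a := by
  unfold liftBase
  rw [ZMod.cast_natCast (dvd_of_eq_mul hN), ZMod.natCast_zmod_val]

omit [DecidableEq Y] in
/-- The sheet base points `liftBase a + i n` reduce to `a` mod `n`. [folklore] -/
theorem cast_liftBase_add [NeZero n] (hN : N = k * n) (a : ZMod n) (i : ℕ) :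
    (ZMod.cast (liftBase N a + ((i * n : ℕ) : ZMod N)) : ZMod n) = a := by
  have hdvd := dvd_of_eq_mul hN
  rw [ZMod.cast_add hdvd, cast_liftBase hN, ZMod.cast_natCast hdvd, Nat.cast_mul,
    ZMod.natCast_self, mul_zero, add_zero]

/-- The lift `liftSet c S` of a set `S` which is `ℓ`-short with base point `c̄` is `ℓ`-short with
base point `c`. [folklore] -/
theorem val_sub_lt_of_mem_liftSet [NeZero n] [NeZero N] (hN : N = k * n) {ℓ : ℕ} {c : ZMod N}
    {S : Finset (ZMod n × Y)} (hS : ∀ x ∈ S, (x.1 - (ZMod.cast c : ZMod n)).val < ℓ)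
    {y : ZMod N × Y} (hy : y ∈ liftSet c S) : (y.1 - c).val < ℓ := by
  obtain ⟨x, hx, rfl⟩ := Finset.mem_image.1 hy
  rw [val_liftPt_fst_sub hN]
  exact hS x hx

/-- Distinct sheets give distinct lifts: `i ↦ liftSet (liftBase a + i n) S` is injective on
`i < k` for non-empty `S`. [folklore] -/
theorem liftSet_sheet_injOn [NeZero n] [NeZero N] (hN : N = k * n) (a : ZMod n)
    {S : Finset (ZMod n × Y)} (hS : S.Nonempty) :
    Set.InjOn (fun i : ℕ => liftSet (liftBase N a + ((i * n : ℕ) : ZMod N)) S) (Finset.range k) := by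
  intro i hi i' hi' h
  simp only [Finset.coe_range, Set.mem_Iio] at hi hi'
  simp only at h
  obtain ⟨x, hx⟩ := hS
  have hmem : liftPt (liftBase N a + ((i * n : ℕ) : ZMod N)) x ∈
      liftSet (liftBase N a + ((i' * n : ℕ) : ZMod N)) S := h ▸ Finset.mem_image_of_mem _ hx
  obtain ⟨x', hx', hxx'⟩ := Finset.mem_image.1 hmem
  have hx'x : x' = x := by
    have := congrArg (proj n) hxx'
    rwa [proj_liftPt hN, proj_liftPt hN] at this
  subst hx'x
  have hfst : liftBase N a + ((i' * n : ℕ) : ZMod N) +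
        (((x'.1 - (ZMod.cast (liftBase N a + ((i' * n : ℕ) : ZMod N)) : ZMod n)).val : ℕ) : ZMod N)
      = liftBase N a + ((i * n : ℕ) : ZMod N) +
        (((x'.1 - (ZMod.cast (liftBase N a + ((i * n : ℕ) : ZMod N)) : ZMod n)).val : ℕ) : ZMod N) :=
    congrArg Prod.fst hxx'
  rw [cast_liftBase_add hN, cast_liftBase_add hN] at hfst
  have hnat : (((i' * n : ℕ)) : ZMod N) = ((i * n : ℕ) : ZMod N) :=
    add_left_cancel (add_right_cancel hfst)
  rw [ZMod.natCast_eq_natCast_iff'] at hnat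
  have hn : 0 < n := Nat.pos_of_ne_zero (NeZero.ne n)
  have hb : ∀ j, j < k → j * n < N := fun j hj => by
    rw [hN]; exact Nat.mul_lt_mul_of_pos_right hj hn
  rw [Nat.mod_eq_of_lt (hb i' hi'), Nat.mod_eq_of_lt (hb i hi)] at hnat
  exact (Nat.eq_of_mul_eq_mul_right hn hnat).symm

end Covering

end PolymerTorus

end Summit.QuantumFields.YangMills.Cruxes.IRcof.TwistedSlab
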